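import Summits.QuantumFields.YangMills.Theorems.BackwardLiouvilleRigidityFlatRatioTerminationSkeletonCells
import Summits.QuantumFields.YangMills.Theorems.BackwardLiouvilleRigidityFlatRatioTerminationCellExtension
import Summits.QuantumFields.YangMills.Theorems.BackwardLiouvilleRigidityFlatRatioTerminationOneBondChains

/-!
# The skeleton gauge: extension over the cells of the three-torus, one dimension at a time
# (toolkit for the stub `stub_innerWindowGaugeSmall` of `BackwardLiouvilleRigidity.FlatRatioTermination`, stmt-QuantumFields-22542)

THE STAGE LEMMA `bondGood_extStep`: if a gauge `v` makes every bond of every aligned cell of dimension `< k` within `ε` of `1`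
(`BondGood … (k−1) ε v`), then redefining `v` on the relative interiors of the `k`-cells by
`quatToSU2 (T_c z) · axialGauge_c` — `T_c` the cell extension (`…CellExtension.cell_extension`) of the boundary data
`z ↦ su2Quat (v(z) · axialGauge_c(z)⁻¹)`, `axialGauge_c` the tree's torus axial gauge of the cell's box
(`T4AxialGaugeSmallField`, box bonds within `4mδ` of `1`) — makes every bond of every aligned cell of dimension `≤ k` within
`4mδ + coneK Λ / m` of `1`, where `ε + 4mδ ≤ Λ/m`.  No error accumulates across cells: each cell sees only its own boundary.
THREE STEPS from `v₀ ≡ 1` give `exists_small_gauge`: `PlaqSmall δ U`, `16m²δ ≤ 1`, `2m ∣ N`, `2m < N` ⟹ a gauge with EVERY bond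
within `gaugeConst / m` of `1`.

HONEST SCOPE.  `--supports stmt-QuantumFields-22542`; a volume-uniform small gauge, nothing about the crux, rung R3 or any summit
statement; nothing here bears on the Yang–Mills mass gap.
-/

namespace Summit.QuantumFields.YangMills.Theorems.FlatRatioTermination.Skeleton

open Literature.MathematicalPhysics.QuantumFieldTheory.Balaban1983to89
open Literature.MathematicalPhysics.QuantumFieldTheory.Balaban1983to89.T3ContinuumYM3Torus
open Literature.MathematicalPhysics.QuantumFieldTheory.Balaban1983to89.T4AxialGaugeSmallField
open Literature.MathematicalPhysics.QuantumLattice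
open B7Prop1Explicit (e e_apply)
open Cone (Cell)
open Cone.Cell (coneK)
open scoped Quaternion

local notation "SU2" => Matrix.specialUnitaryGroup (Fin 2) ℂ

/-! ## §1 The chosen extension of boundary data over a cell -/

section Ext

/-- A good extension of boundary data `t` over the cell `c` with bond budget `B`. [folklore] -/
def GoodExt (c : Cell 3) (t : (Fin 3 → ℤ) → ℍ) (B : ℝ) (T : (Fin 3 → ℤ) → ℍ) : Prop :=
  (∀ x ∈ c.bdry, T x = t x) ∧ (∀ x, ‖T x‖ = 1) ∧
    ∀ (x : Fin 3 → ℤ) (ι : Fin 3), x ∈ c.box → x + Pi.single ι 1 ∈ c.box → ‖T x - T (x + Pi.single ι 1)‖ ≤ B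

open scoped Classical in
/-- A chosen good extension (the data itself if none exists). [folklore] -/
noncomputable def extT (c : Cell 3) (t : (Fin 3 → ℤ) → ℍ) (B : ℝ) : (Fin 3 → ℤ) → ℍ :=
  if h : ∃ T, GoodExt c t B T then Classical.choose h else t

/-- The chosen extension is good whenever a good extension exists. [folklore] -/
theorem extT_spec {c : Cell 3} {t : (Fin 3 → ℤ) → ℍ} {B : ℝ} (h : ∃ T, GoodExt c t B T) : GoodExt c t B (extT c t B) := by
  unfold extT; rw [dif_pos h]; exact Classical.choose_spec h

end Ext

/-! ## §2 The extension step on the torus -/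

section Stage

variable (F : T3Family) (K : ℕ) (U : GaugeField (F.P K) 0 SU2) (m : ℕ)

/-- The boundary data of a cell seen from the gauge `v`: `z ↦ su2Quat (v(z) · axialGauge_c(z)⁻¹)`. [folklore] -/
noncomputable def cellData (v : GaugeTransf (F.P K) 0 SU2) (c : Cell 3) : (Fin 3 → ℤ) → ℍ :=
  fun z => su2Quat (v (castSite z) * (axialGauge U c.lo c.hi (castSite z))⁻¹)

/-- THE EXTENSION STEP at dimension `k` with bond budget `B`: on sites whose cell has dimension `k`, `quatToSU2 (T_c z) · axialGauge_c`;
elsewhere `v`. [folklore] -/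
noncomputable def extStep (B : ℝ) (k : ℕ) (v : GaugeTransf (F.P K) 0 SU2) : GaugeTransf (F.P K) 0 SU2 := fun s =>
  if (cellAt m (rep F K s)).D.card = k then
    quatToSU2 (extT (cellAt m (rep F K s)) (cellData F K U v (cellAt m (rep F K s))) B (rep F K s))
      * axialGauge U (cellAt m (rep F K s)).lo (cellAt m (rep F K s)).hi s
  else v s

/-- Every bond of every aligned cell of dimension `≤ k` is within `ε` of `1` in the gauge `v`. [folklore] -/
def BondGood (k : ℕ) (ε : ℝ) (v : GaugeTransf (F.P K) 0 SU2) : Prop :=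
  ∀ c ∈ cells m, c.D.card ≤ k → ∀ (x : Fin 3 → ℤ) (ι : Fin 3), x ∈ c.box → x + e ι ∈ c.box →
    dist1 (v (castSite x) * U ⟨castSite x, ι⟩ * (v (castSite (x + e ι)))⁻¹) ≤ ε

variable {F K U m}

/-- Sites of unchanged dimension keep their value. [folklore] -/
theorem extStep_of_ne {B : ℝ} {k : ℕ} {v : GaugeTransf (F.P K) 0 SU2} {s : Site (F.P K) 0}
    (h : (cellAt m (rep F K s)).D.card ≠ k) : extStep F K U m B k v s = v s := by
  simp [extStep, h]

/-- `2m ∣ rep (castSite z) κ − z κ` when `2m ∣ N`. [folklore] -/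
theorem dvd_rep_sub (hN : (2 * m : ℤ) ∣ ((F.P K).sitesPerDir 0 : ℤ)) (z : Fin 3 → ℤ) (κ : Fin 3) :
    (2 * m : ℤ) ∣ rep F K (castSite z : Site (F.P K) 0) κ - z κ :=
  hN.trans (dvd_rep_castSite_sub F K z κ)

/-- THE AXIAL BOUND on a cell: every bond of the box of an aligned cell is within `4mδ` of `1` in the cell's axial gauge. [folklore] -/
theorem axial_bond_le {δ : ℝ} (hδ0 : 0 ≤ δ) (hU : PlaqSmall δ U) (h2mN : 2 * m < (F.P K).sitesPerDir 0)
    {c : Cell 3} (hc : c ∈ cells m) {x : Fin 3 → ℤ} {ι : Fin 3} (hx : x ∈ c.box) (hy : x + e ι ∈ c.box) :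
    dist1 (axialGauge U c.lo c.hi (castSite x) * U ⟨castSite x, ι⟩ * (axialGauge U c.lo c.hi (castSite (x + e ι)))⁻¹)
      ≤ 4 * m * δ := by
  have hn : ∀ κ, c.hi κ ≤ c.lo κ + ((2 * m : ℕ) : ℤ) := by
    intro κ
    by_cases h : κ ∈ c.D
    · rw [c.hi_of_mem h, hc.1]; push_cast; exact le_rfl
    · rw [c.hi_of_not_mem h]; push_cast; omega
  have hlo : c.lo ≤ x := fun κ => (hx κ).1
  have hhi : x + e ι ≤ c.hi := fun κ => (hy κ).2
  have h := dist1_gaugeAct_axialGauge_le_uniform U (S₀ := Set.univ) (Set.subset_univ _) (fun p _ => hU p) hδ0 hn h2mN hlo hhi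
  have hd : (((F.P K).d - 1 : ℕ) : ℝ) = 2 := by norm_num [T3Family.P_d]
  rw [hd] at h
  simp only [GaugeField.gaugeAct, PBond.tgt, ← castSite_add_e] at h
  push_cast at h
  calc _ ≤ 2 * (2 * (m : ℝ)) * δ := h
    _ = 4 * m * δ := by ring

variable (hm : 1 ≤ m) (hN : (2 * m : ℤ) ∣ ((F.P K).sitesPerDir 0 : ℤ)) (h2mN : 2 * m < (F.P K).sitesPerDir 0)
  {δ : ℝ} (hδ0 : 0 ≤ δ) (hU : PlaqSmall δ U)
include hm hN h2mN hδ0 hU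

/-- THE STAGE LEMMA ON A REDUCED CELL of dimension `k`. [folklore] -/
theorem stage_reduced {k : ℕ} {ε Λ : ℝ} (hε : 0 ≤ ε) (hΛ : ε + 4 * m * δ ≤ Λ / m)
    {v : GaugeTransf (F.P K) 0 SU2} (hv : BondGood F K U m (k - 1) ε v)
    {c : Cell 3} (hc : c ∈ cells m) (hred : ∀ κ, 0 ≤ c.lo κ ∧ c.lo κ < ((F.P K).sitesPerDir 0 : ℤ)) (hck : c.D.card = k)
    {x : Fin 3 → ℤ} {ι : Fin 3} (hx : x ∈ c.box) (hy : x + e ι ∈ c.box) :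
    dist1 (extStep F K U m (coneK Λ / m) k v (castSite x) * U ⟨castSite x, ι⟩ *
        (extStep F K U m (coneK Λ / m) k v (castSite (x + e ι)))⁻¹) ≤ 4 * m * δ + coneK Λ / m := by
  set N : ℤ := ((F.P K).sitesPerDir 0 : ℤ) with hNdef
  set B : ℝ := coneK Λ / m with hB
  set a : GaugeTransf (F.P K) 0 SU2 := axialGauge U c.lo c.hi with ha
  set t : (Fin 3 → ℤ) → ℍ := cellData F K U v c with ht
  set w := extStep F K U m B k v with hw
  have hcm : c.m = m := hc.1
  have hmc : 1 ≤ c.m := hcm ▸ hm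
  -- (1) the chosen extension is good
  have hgood : GoodExt c t B (extT c t B) := by
    apply extT_spec
    have ht1 : ∀ z ∈ c.bdry, ‖t z‖ = 1 := fun z _ => norm_su2Quat _
    have hts : c.BdrySteps t (ε + 4 * m * δ) := by
      intro z ι' hz hz'
      change ‖t z - t (z + e ι')‖ ≤ ε + 4 * m * δ
      simp only [ht, cellData]
      rw [norm_su2Quat_sub]
      refine (dist1_quot_le _ _ _ _ (U ⟨castSite z, ι'⟩)).trans (add_le_add ?_ ?_)
      · obtain ⟨c', hc', hlt, hzb, hzb'⟩ := face_cell hm hc hz hz'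
        exact hv c' hc' (by omega) z ι' hzb hzb'
      · exact axial_bond_le hδ0 hU h2mN hc hz.1 hz'.1
    have hΛ' : ε + 4 * m * δ ≤ Λ / c.m := by rw [hcm]; exact hΛ
    obtain ⟨T, h1, h2, h3⟩ := c.cell_extension Λ hmc t (by positivity) hΛ' ht1 hts
    exact ⟨T, h1, h2, by rw [hB, ← hcm]; exact h3⟩
  -- (2) the endpoint formula on the closed box
  have hend : ∀ z ∈ c.box, w (castSite z) = quatToSU2 (extT c t B z) * a (castSite z) := by
    intro z hz
    by_cases hzb : z ∈ c.bdry
    · have hlt := card_cellAt_D_lt hc hzb (dvd_rep_sub hN z)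
      rw [hw, extStep_of_ne (by omega), hgood.1 z hzb, ht]
      exact (quatToSU2_su2Quat_mul_inv_mul _ _).symm
    · -- relative interior: the representative is `z` itself and its cell is `c`
      have hzN : ∀ κ, 0 ≤ z κ ∧ z κ < N := by
        intro κ
        have h := hz κ
        refine ⟨(hred κ).1.trans h.1, ?_⟩
        by_cases hD : κ ∈ c.D
        · rw [c.hi_of_mem hD, hcm] at h
          have hne : z κ ≠ c.lo κ + 2 * m := fun h' => hzb ⟨hz, κ, hD, Or.inr (by rw [hcm]; exact h')⟩
          have := lo_add_le_of_reduced hm hc hN (hred κ).2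
          omega
        · rw [c.hi_of_not_mem hD] at h; linarith [(hred κ).2]
      have hrep : rep F K (castSite z : Site (F.P K) 0) = z := rep_castSite F K hzN
      have hcell : cellAt m z = c := cellAt_eq_of_not_mem_bdry hm hc hz hzb
      simp only [hw, extStep, hrep, hcell, hck, if_true]
      rfl
  -- (3) the bound
  rw [hend x hx, hend (x + e ι) hy]
  have e1 : quatToSU2 (extT c t B x) * a (castSite x) * U ⟨castSite x, ι⟩ *
      (quatToSU2 (extT c t B (x + e ι)) * a (castSite (x + e ι)))⁻¹
      = quatToSU2 (extT c t B x) * (a (castSite x) * U ⟨castSite x, ι⟩ * (a (castSite (x + e ι)))⁻¹) *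
        (quatToSU2 (extT c t B (x + e ι)))⁻¹ := by group
  rw [e1]
  refine (dist1_insert _ _ _).trans (add_le_add (axial_bond_le hδ0 hU h2mN hc hx hy) ?_)
  rw [dist1_quatToSU2_mul_inv (hgood.2.1 _) (hgood.2.1 _)]
  exact hgood.2.2 x ι hx hy

/-- **THE STAGE LEMMA.**  `BondGood (k−1) ε v` and `ε + 4mδ ≤ Λ/m` give `BondGood k (4mδ + coneK Λ/m)` for the extension step
(provided the old budget fits in the new one). [folklore] -/
theorem bondGood_extStep {k : ℕ} (hk : 1 ≤ k) {ε Λ : ℝ} (hε : 0 ≤ ε) (hΛ : ε + 4 * m * δ ≤ Λ / m)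
    (hεB : ε ≤ 4 * m * δ + coneK Λ / m) {v : GaugeTransf (F.P K) 0 SU2} (hv : BondGood F K U m (k - 1) ε v) :
    BondGood F K U m k (4 * m * δ + coneK Λ / m) (extStep F K U m (coneK Λ / m) k v) := by
  intro c hc hck x ι hx hy
  have hN0 : (0 : ℤ) < ((F.P K).sitesPerDir 0 : ℤ) := by exact_mod_cast (lt_of_le_of_lt (Nat.zero_le _) h2mN)
  rcases lt_or_eq_of_le hck with hlt | heq
  · -- lower cell: nothing changed
    have h1 := card_cellAt_D_le hc hx (dvd_rep_sub hN x)
    have h2 := card_cellAt_D_le hc hy (dvd_rep_sub hN (x + e ι))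
    rw [extStep_of_ne (by omega), extStep_of_ne (by omega)]
    exact (hv c hc (by omega) x ι hx hy).trans hεB
  · -- top cell: reduce, then `stage_reduced`
    obtain ⟨w₀, hc', hred⟩ := exists_reduced hc hN hN0
    have hx' : x - (fun κ => ((F.P K).sitesPerDir 0 : ℤ) * w₀ κ) ∈
        (translate c (fun κ => ((F.P K).sitesPerDir 0 : ℤ) * w₀ κ)).box := (mem_box_translate c _ x).mp hx
    have hy' : x - (fun κ => ((F.P K).sitesPerDir 0 : ℤ) * w₀ κ) + e ι ∈
        (translate c (fun κ => ((F.P K).sitesPerDir 0 : ℤ) * w₀ κ)).box := by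
      have := (mem_box_translate c (fun κ => ((F.P K).sitesPerDir 0 : ℤ) * w₀ κ) (x + e ι)).mp hy
      rwa [add_sub_right_comm] at this
    have hcs1 : (castSite (x - (fun κ => ((F.P K).sitesPerDir 0 : ℤ) * w₀ κ)) : Site (F.P K) 0) = castSite x :=
      castSite_eq_of_modEq F K fun κ => ⟨-w₀ κ, by simp only [Pi.sub_apply]; ring⟩
    have hcs2 : (castSite (x - (fun κ => ((F.P K).sitesPerDir 0 : ℤ) * w₀ κ) + e ι) : Site (F.P K) 0) =
        castSite (x + e ι) :=
      castSite_eq_of_modEq F K fun κ => ⟨-w₀ κ, by simp only [Pi.sub_apply, Pi.add_apply]; ring⟩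
    have := stage_reduced hm hN h2mN hδ0 hU hε hΛ hv hc' hred (by exact heq) hx' hy'
    rwa [hcs1, hcs2] at this

omit hm h2mN hδ0 hU in
/-- The extension step changes nothing on the closed boxes of lower cells. [folklore] -/
theorem extStep_eq_on_lower {B : ℝ} {k : ℕ} {v : GaugeTransf (F.P K) 0 SU2} {c : Cell 3} (hc : c ∈ cells m)
    (hck : c.D.card < k) {z : Fin 3 → ℤ} (hz : z ∈ c.box) : extStep F K U m B k v (castSite z) = v (castSite z) :=
  extStep_of_ne (by have := card_cellAt_D_le hc hz (dvd_rep_sub hN z); omega)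

end Stage

/-! ## §3 Three steps from the trivial gauge -/

section Assembly

variable (F : T3Family) (K : ℕ) (U : GaugeField (F.P K) 0 SU2) (m : ℕ) (δ : ℝ)

/-- `coneK` dominates its argument. [folklore] -/
theorem le_coneK (Λ : ℝ) : Λ ≤ coneK Λ := by
  unfold coneK
  have h1 : Λ ≤ max Λ 1 := le_max_left _ _
  have h2 : (1 : ℝ) ≤ max Λ 1 := le_max_right _ _
  nlinarith [sq_nonneg (12 * max Λ 1 + 3), mul_pos (by positivity : (0:ℝ) < 100 * (12 * max Λ 1 + 3) ^ 2) (by linarith : (0:ℝ) < 16 + 36 * max Λ 1)]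

/-- `coneK` is monotone. [folklore] -/
theorem coneK_mono {a b : ℝ} (h : a ≤ b) : coneK a ≤ coneK b := by
  unfold coneK
  have h1 : max a 1 ≤ max b 1 := max_le_max h le_rfl
  have h2 : (1 : ℝ) ≤ max a 1 := le_max_right _ _
  have h3 : (0 : ℝ) ≤ 12 * max a 1 + 3 := by linarith
  have h4 : (12 * max a 1 + 3) ^ 2 ≤ (12 * max b 1 + 3) ^ 2 := by nlinarith
  have h5 : (0 : ℝ) ≤ 16 + 36 * max a 1 := by linarith
  calc 100 * (12 * max a 1 + 3) ^ 2 * (16 + 36 * max a 1)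
      ≤ 100 * (12 * max b 1 + 3) ^ 2 * (16 + 36 * max a 1) := by gcongr
    _ ≤ 100 * (12 * max b 1 + 3) ^ 2 * (16 + 36 * max b 1) := by gcongr

/-- The budgets of the three steps. [folklore] -/
noncomputable def lam2 : ℝ := 1 / 2 + coneK (1 / 4)

/-- The budgets of the three steps. [folklore] -/
noncomputable def lam3 : ℝ := 1 / 2 + coneK lam2

/-- THE FINAL BOND CONSTANT of the skeleton gauge: every bond within `gaugeConst / m` of `1`. [folklore] -/
noncomputable def gaugeConst : ℝ := 1 / 4 + coneK lam3

/-- THE SKELETON GAUGE: three extension steps (edges, faces, cubes) from the trivial gauge. [folklore] -/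
noncomputable def skeletonGauge : GaugeTransf (F.P K) 0 SU2 :=
  extStep F K U m (coneK lam3 / m) 3 (extStep F K U m (coneK lam2 / m) 2 (extStep F K U m (coneK (1 / 4) / m) 1 (fun _ => 1)))

variable {F K U m δ}

/-- The trivial gauge is good in dimension `0` (there are no bonds in a `0`-cell). [folklore] -/
theorem bondGood_zero : BondGood F K U m 0 0 (fun _ => 1) := by
  intro c hc hck x ι hx hy
  exfalso
  have : ι ∈ c.D := c.mem_D_of_bond hx hy
  rw [Finset.card_eq_zero.mp (Nat.le_zero.mp hck)] at this
  simp at this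

/-- **THE SMALL GAUGE.**  If every plaquette variable is within `δ` of `1`, `16m²δ ≤ 1`, `2m ∣ N` and `2m < N`, the skeleton gauge
puts EVERY bond variable within `gaugeConst / m` of `1`. [folklore] -/
theorem dist1_skeletonGauge_le (hm : 1 ≤ m) (hN : (2 * m : ℤ) ∣ ((F.P K).sitesPerDir 0 : ℤ))
    (h2mN : 2 * m < (F.P K).sitesPerDir 0) (hδ0 : 0 ≤ δ) (hU : PlaqSmall δ U) (hsmall : 16 * (m : ℝ) ^ 2 * δ ≤ 1)
    (b : PBond (F.P K) 0) : dist1 (GaugeField.gaugeAct (skeletonGauge F K U m) U b) ≤ gaugeConst / m := by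
  have hm' : (0 : ℝ) < m := by exact_mod_cast hm
  have h4m : 4 * m * δ ≤ 1 / (4 * m) := by
    rw [le_div_iff₀ (by positivity)]; nlinarith
  -- step 1
  have hΛ1 : 0 + 4 * m * δ ≤ (1 / 4) / m := by rw [zero_add, div_div]; linarith [h4m, show (4:ℝ) * m = 4 * m from rfl]
  have hK1 := Cone.Cell.coneK_pos (1 / 4)
  have hK2 := Cone.Cell.coneK_pos lam2
  have hK3 := Cone.Cell.coneK_pos lam3
  have hmδ : 0 ≤ 4 * (m : ℝ) * δ := by positivity
  have h1 := bondGood_extStep hm hN h2mN hδ0 hU (k := 1) le_rfl le_rfl hΛ1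
    (by have := div_pos hK1 hm'; linarith) bondGood_zero
  -- step 2
  set ε₁ : ℝ := 4 * m * δ + coneK (1 / 4) / m with hε₁
  have hΛ2 : ε₁ + 4 * m * δ ≤ lam2 / m := by
    rw [hε₁, lam2, add_div]
    have : (1 : ℝ) / 2 / m = 1 / (4 * m) + 1 / (4 * m) := by field_simp; ring
    linarith
  have hεB2 : ε₁ ≤ 4 * m * δ + coneK lam2 / m := by
    rw [hε₁]
    have : coneK (1 / 4) ≤ coneK lam2 := coneK_mono (by unfold lam2; linarith [Cone.Cell.coneK_pos (1/4)])
    have := div_le_div_of_nonneg_right this hm'.le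
    linarith
  have hε₁0 : 0 ≤ ε₁ := by rw [hε₁]; have := div_pos hK1 hm'; linarith
  have h2 := bondGood_extStep hm hN h2mN hδ0 hU (k := 2) (by norm_num) hε₁0 hΛ2 hεB2 h1
  -- step 3
  set ε₂ : ℝ := 4 * m * δ + coneK lam2 / m with hε₂
  have hΛ3 : ε₂ + 4 * m * δ ≤ lam3 / m := by
    rw [hε₂, lam3, add_div]
    have : (1 : ℝ) / 2 / m = 1 / (4 * m) + 1 / (4 * m) := by field_simp; ring
    linarith
  have hεB3 : ε₂ ≤ 4 * m * δ + coneK lam3 / m := by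
    rw [hε₂]
    have : coneK lam2 ≤ coneK lam3 := coneK_mono (by unfold lam3; linarith [le_coneK lam2])
    have := div_le_div_of_nonneg_right this hm'.le
    linarith
  have hε₂0 : 0 ≤ ε₂ := by rw [hε₂]; have := div_pos hK2 hm'; linarith
  have h3 := bondGood_extStep hm hN h2mN hδ0 hU (k := 3) (by norm_num) hε₂0 hΛ3 hεB3 h2
  -- every bond lies in the closed box of an aligned cell of dimension ≤ 3
  set s : Site (F.P K) 0 := b.src with hs
  set μ : Fin 3 := b.dir with hμ
  have hb : b = ⟨s, μ⟩ := by cases b; rfl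
  set x := rep F K s with hx
  set c : Cell 3 := ⟨(cellAt m x).lo, insert μ (cellAt m x).D, m⟩ with hc
  have e1 : (x + e μ) μ = x μ + 1 := by simp [e_apply]
  have e2 : ∀ κ, κ ≠ μ → (x + e μ) κ = x κ := fun κ h => by simp [e_apply, h]
  have hcells : c ∈ cells m := ⟨rfl, fun κ => ⟨x κ / (2 * m), rfl⟩⟩
  have hbx := mem_box_cellAt hm x
  have hμb := ediv_bounds hm (x μ)
  have hxc : x ∈ c.box := by
    intro κ
    have h := hbx κ
    by_cases hκ : κ ∈ (cellAt m x).D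
    · have : κ ∈ c.D := Finset.mem_insert_of_mem hκ
      rw [c.hi_of_mem this]; rw [(cellAt m x).hi_of_mem hκ] at h; exact h
    · by_cases hκμ : κ = μ
      · rw [hκμ] at h hκ ⊢
        rw [c.hi_of_mem (Finset.mem_insert_self μ _)]
        simp only [hc, cellAt_lo]; omega
      · have : κ ∉ c.D := by simp [hc, hκμ, hκ]
        rw [c.hi_of_not_mem this]; rw [(cellAt m x).hi_of_not_mem hκ] at h; exact h
  have hyc : x + e μ ∈ c.box := by
    intro κ
    have h := hxc κ
    by_cases hκμ : κ = μ
    · rw [hκμ, e1]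
      rw [hκμ, c.hi_of_mem (Finset.mem_insert_self μ _)] at h
      rw [c.hi_of_mem (Finset.mem_insert_self μ _)]
      simp only [hc, cellAt_lo] at h ⊢; omega
    · rw [e2 κ hκμ]; exact h
  have hcard : c.D.card ≤ 3 := by simpa using Finset.card_le_univ c.D
  have key := h3 c hcells hcard x μ hxc hyc
  have hsrc : (castSite x : Site (F.P K) 0) = s := castSite_rep F K s
  have hcs : (castSite (x + e μ) : Site (F.P K) 0) = (castSite x).shift μ := castSite_add_e (P := F.P K) (j := 0) x μ
  rw [hcs, hsrc] at key
  rw [hb]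
  refine (le_of_eq_of_le rfl key).trans ?_
  rw [gaugeConst, add_div, div_div]
  linarith

end Assembly

end Summit.QuantumFields.YangMills.Theorems.FlatRatioTermination.Skeleton
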